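import Summits.Langlands.Langlands.Theses.ImaginaryQuadraticAnchor
import Literature.NumberTheory.Automorphic.AutomorphicInductionCuspidal
import Literature.NumberTheory.Automorphic.HenniartAutomorphicInduction

/-!
# Birth skeleton (BC3) for the crux `WeakAutomorphicInduction` (stmt-Langlands-18735)
# of route-Langlands-ImaginaryQuadraticAnchor — line `birth`: TOWER REDUCTION TO PRIMITIVE EXTENSIONS

Crux (fixed, the route's decl): weak automorphic induction of an L-algebraic cuspidal `π` of
`GL_n(𝔸_L)` along an ARBITRARY finite extension `L ⊃ K` of an imaginary quadratic field `K`,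
landing in an equal-slope family of L-algebraic cuspidals `P_1, …, P_r` over `K` whose summed
Satake polynomials are `∏_(v ∣ w) SatPoly(π_v)(X^f(v|w))` at almost every `w` (Arthur–Clozel 1989,
Ch. 3, Def. 6.1 shape).

Line.  The field variable `L/K` is attacked through the lattice of intermediate fields:
* `stub_primitiveCase` (load-bearing, the open core): the crux-shaped statement for a PRIMITIVE
  extension `L/K` (no intermediate field strictly between `K` and `L`) of an arbitrary TOTALLY
  COMPLEX base `K` (every field between an imaginary quadratic field and `L` is totally complex, and
  automorphic induction at complex places is the plain sum of Harish-Chandra parameters, so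
  L-algebraicity is functorial there).  Its known rungs: `[L:K]` prime with cyclic Galois group
  (Arthur–Clozel Thm. 6.2 + Lemma 6.3/6.4, Henniart 2012 at infinity) — see `stub_cyclicPrimeCase`;
  non-normal cubic for `n = 1` (Jacquet–Piatetski-Shapiro–Shalika).  Open: primitive `L/K` with
  insoluble Galois closure (e.g. `A₅`-quintics), i.e. non-solvable automorphic induction.
* `stub_towerReduction` (load-bearing, closable now): the primitive case over all totally complex
  bases implies the general case over all totally complex bases — strong induction on `[L:K]`
  through an intermediate field `K ⊊ M ⊊ L`, inducing the family member by member
  (`IsAutomorphicInductionAlong.trans`, `isAutomorphicInductionAlong_of_satake_sum`,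
  `inducedSatakePolynomial_tower`, `eventually_forall_under_eq`, `finite_setOf_asIdeal_under_eq`
  are the tree's bookkeeping for exactly this), concatenating families (`finSigmaFinEquiv`),
  carrying L-algebraicity verbatim and the common slope `σ` through `q_u = q_w^f(u|w)` and the
  uniqueness of the slope of a cuspidal representation (central character:
  `AutomorphicRepData.exists_centralCharacter`, `HeckeCharacter.exists_norm_detTwist_eq_ideleNorm_rpow`).
* `stub_cyclicPrimeCase` (BC5 plan-only rung, first prover target; it lies INSIDE the domain of
  `stub_primitiveCase`, an extension of prime degree being primitive): the crux in the cyclic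
  prime-degree case off the Galois-stable locus, from the vendored named facts
  `automorphicInduction_cyclic_cuspidal` (Arthur–Clozel Thm. 6.2 / Lemma 6.4: a CUSPIDAL induced
  representation, `r = 1`), `Henniart2012_infinityType_of_automorphicInduction` (archimedean
  parameters of the induced representation = sum over the embeddings above) and the existence of
  infinity types (`AutomorphicRepData.exists_hasInfinityType`, Clozel 1990 §3.3); the slope clause
  follows from the Satake identity alone (`‖∏ f-th roots‖ = ∏_(v∣w) ‖β_v.prod‖ = q_w^(n[L:K]σ)`).
Assembly `WeakAutomorphicInduction_of`: specialise the general statement delivered by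
`stub_towerReduction stub_primitiveCase` to the imaginary quadratic base (pure logic).

Disproof used: none on file for this crux (`ledger crux ls`: no Disproof.lean; negatives index of
the summit has no statement of this shape — refuter note 2026-08-17 on the item).  Dead lines: none
recorded.  The earlier registered split (existence of the family / slopes-and-algebraicity of every
such family, planner-type-573875563d) remains available as a resplit of `stub_primitiveCase`.
-/

namespace Summit.Langlands.Langlands.Cruxes.WeakAutomorphicInduction.Birth

open scoped BigOperators Polynomial NumberField Classical
open Filter

/-- **Primitive case (the open core).**  For a totally complex number field `K`, a finite extension
`L/K` with NO intermediate field other than `K` and `L`, `n ≥ 1` and an L-algebraic cuspidal `π`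
of `GL_n(𝔸_L)`: there is an equal-slope family of L-algebraic cuspidal `P_i` on `GL_(m_i)(𝔸_K)`
(`m_i ≥ 1`) whose summed Satake polynomials at almost every `w` equal
`∏_(v ∣ w) SatPoly(π_v)(X^f(v|w))`.  Why plausibly true: it is Langlands functoriality for the
L-homomorphism `Ind_L^K` (unramified shadow), with L-algebraicity preserved at the complex places of
`K`; known for `[L:K]` cyclic prime (Arthur–Clozel 1989 Thm. 6.2, Henniart 2012) and for `n = 1`,
`[L:K] = 3` non-normal (JPSS).  Size: open problem in the insoluble-closure case (Getz–Hahn GTM 300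
p. 275).  [cite: ArthurClozelAMS120, Ch. 3 Def. 6.1, Thm. 6.2] [cite: Henniart2012, Thm. 3–5] -/
theorem stub_primitiveCase : ∀ (K L : Type) [Field K] [NumberField K] [Field L] [NumberField L] [Algebra K L], (∀ M : IntermediateField K L, M = ⊥ ∨ M = ⊤) → NumberField.IsTotallyComplex K → ∀ (n : ℕ), 0 < n → ∀ (hL : Literature.NumberTheory.Automorphic.isCompact_glFiniteIntegralLevel n L) (π : Literature.NumberTheory.Automorphic.CuspidalAutomorphicRepData n L hL), π.1.IsLAlgebraic → ∃ (r : ℕ) (m : Fin r → ℕ) (hK : ∀ i, Literature.NumberTheory.Automorphic.isCompact_glFiniteIntegralLevel (m i) K) (P : ∀ i, Literature.NumberTheory.Automorphic.CuspidalAutomorphicRepData (m i) K (hK i)), (∀ i, 0 < m i ∧ (P i).1.IsLAlgebraic) ∧ (∃ σ : ℝ, (∀ᶠ v : IsDedekindDomain.HeightOneSpectrum (NumberField.RingOfIntegers L) in cofinite, ∀ β : Multiset ℂ, π.1.HasSatakeParamAt v β → ‖β.prod‖ = (v.residueCard : ℝ) ^ ((n : ℝ) * σ)) ∧ ∀ i,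 ∀ᶠ w : IsDedekindDomain.HeightOneSpectrum (NumberField.RingOfIntegers K) in cofinite, ∀ α : Multiset ℂ, (P i).1.HasSatakeParamAt w α → ‖α.prod‖ = (w.residueCard : ℝ) ^ ((m i : ℝ) * σ)) ∧ ∀ᶠ w : IsDedekindDomain.HeightOneSpectrum (NumberField.RingOfIntegers K) in cofinite, ∀ β : IsDedekindDomain.HeightOneSpectrum (NumberField.RingOfIntegers L) → Multiset ℂ, (∀ v : IsDedekindDomain.HeightOneSpectrum (NumberField.RingOfIntegers L), v.asIdeal.under (NumberField.RingOfIntegers K) = w.asIdeal → π.1.HasSatakeParamAt v (β v)) → ∃ α : Fin r → Multiset ℂ, (∀ i, (P i).1.HasSatakeParamAt w (α i)) ∧ Literature.NumberTheory.Automorphic.satakePolynomial (Finset.univ.sum α) = ∏ᶠ v ∈ {v : IsDedekindDomain.HeightOneSpectrum (NumberField.RingOfIntegers L) | v.asIdeal.under (NumberField.RingOfIntegers K) = w.asIdeal}, (Literature.NumberTheory.Automorphic.satakePolynomial (β v)).comp (Polynomial.X ^ v.asIdeal.inertiaDeg (NumberField.RingOfIntegers K)) := by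
  sorry

/-- **Tower reduction (induction in stages for families).**  If the primitive case holds over every
totally complex base, then weak automorphic induction (same conclusion) holds along EVERY finite
extension `L/K` of a totally complex `K`: strong induction on `[L:K]`; a non-primitive `L/K` has an
intermediate `K ⊊ M ⊊ L` with `[L:M], [M:K] < [L:K]`, `M` totally complex; induce `π` to a family
over `M`, induce each member to a family over `K`, concatenate; the Satake identity composes by
`f(v|u) = f(v|w) f(w|u)` (`inducedSatakePolynomial_tower`, `IsAutomorphicInductionAlong.trans`,
`isAutomorphicInductionAlong_of_satake_sum` are the `r = 1` / isobaric templates), L-algebraicity is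
carried verbatim and the common slope through `q_w = q_u^f(w|u)` and uniqueness of slopes.  Why it
might fail: only by a typing slip (it is Arthur–Clozel's "induction by stages", Ch. 3 §6, PDF
p. 184, for families).  Size: M–L (bookkeeping over `finprod`/`Fin`-indexed families).
[cite: ArthurClozelAMS120, Ch. 3 §6 (induction in stages)] -/
theorem stub_towerReduction : (∀ (K L : Type) [Field K] [NumberField K] [Field L] [NumberField L] [Algebra K L], (∀ M : IntermediateField K L, M = ⊥ ∨ M = ⊤) → NumberField.IsTotallyComplex K → ∀ (n : ℕ), 0 < n → ∀ (hL : Literature.NumberTheory.Automorphic.isCompact_glFiniteIntegralLevel n L) (π : Literature.NumberTheory.Automorphic.CuspidalAutomorphicRepData n L hL), π.1.IsLAlgebraic → ∃ (r : ℕ) (m : Fin r → ℕ) (hK : ∀ i, Literature.NumberTheory.Automorphic.isCompact_glFiniteIntegralLevel (m i) K) (P : ∀ i, Literature.NumberTheory.Automorphic.CuspidalAutomorphicRepData (m i) K (hK i)), (∀ i, 0 < m i ∧ (P i).1.IsLAlgebraic) ∧ (∃ σ : ℝ, (∀ᶠ v : IsDedekindDomain.HeightOneSpectrum (NumberField.RingOfIntegers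 L) in cofinite, ∀ β : Multiset ℂ, π.1.HasSatakeParamAt v β → ‖β.prod‖ = (v.residueCard : ℝ) ^ ((n : ℝ) * σ)) ∧ ∀ i, ∀ᶠ w : IsDedekindDomain.HeightOneSpectrum (NumberField.RingOfIntegers K) in cofinite, ∀ α : Multiset ℂ, (P i).1.HasSatakeParamAt w α → ‖α.prod‖ = (w.residueCard : ℝ) ^ ((m i : ℝ) * σ)) ∧ ∀ᶠ w : IsDedekindDomain.HeightOneSpectrum (NumberField.RingOfIntegers K) in cofinite, ∀ β : IsDedekindDomain.HeightOneSpectrum (NumberField.RingOfIntegers L) → Multiset ℂ, (∀ v : IsDedekindDomain.HeightOneSpectrum (NumberField.RingOfIntegers L), v.asIdeal.under (NumberField.RingOfIntegers K) = w.asIdeal → π.1.HasSatakeParamAt v (β v)) → ∃ α : Fin r → Multiset ℂ, (∀ i, (P i).1.HasSatakeParamAt w (α i)) ∧ Literature.NumberTheory.Automorphic.satakePolynomial (Finset.univ.sum α) = ∏ᶠ v ∈ {v : IsDedekindDomain.HeightOneSpectrum (NumberField.RingOfIntegers L) | v.asIdeal.under (NumberField.RingOfIntegers K) = w.asIdeal},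 (Literature.NumberTheory.Automorphic.satakePolynomial (β v)).comp (Polynomial.X ^ v.asIdeal.inertiaDeg (NumberField.RingOfIntegers K))) → ∀ (K L : Type) [Field K] [NumberField K] [Field L] [NumberField L] [Algebra K L], NumberField.IsTotallyComplex K → ∀ (n : ℕ), 0 < n → ∀ (hL : Literature.NumberTheory.Automorphic.isCompact_glFiniteIntegralLevel n L) (π : Literature.NumberTheory.Automorphic.CuspidalAutomorphicRepData n L hL), π.1.IsLAlgebraic → ∃ (r : ℕ) (m : Fin r → ℕ) (hK : ∀ i, Literature.NumberTheory.Automorphic.isCompact_glFiniteIntegralLevel (m i) K) (P : ∀ i, Literature.NumberTheory.Automorphic.CuspidalAutomorphicRepData (m i) K (hK i)), (∀ i, 0 < m i ∧ (P i).1.IsLAlgebraic) ∧ (∃ σ : ℝ, (∀ᶠ v : IsDedekindDomain.HeightOneSpectrum (NumberField.RingOfIntegers L) in cofinite, ∀ β : Multiset ℂ, π.1.HasSatakeParamAt v β → ‖β.prod‖ = (v.residueCard : ℝ) ^ ((n : ℝ) * σ)) ∧ ∀ i, ∀ᶠ w : IsDedekindDomain.HeightOneSpectrum (NumberField.RingOfIntegers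 K) in cofinite, ∀ α : Multiset ℂ, (P i).1.HasSatakeParamAt w α → ‖α.prod‖ = (w.residueCard : ℝ) ^ ((m i : ℝ) * σ)) ∧ ∀ᶠ w : IsDedekindDomain.HeightOneSpectrum (NumberField.RingOfIntegers K) in cofinite, ∀ β : IsDedekindDomain.HeightOneSpectrum (NumberField.RingOfIntegers L) → Multiset ℂ, (∀ v : IsDedekindDomain.HeightOneSpectrum (NumberField.RingOfIntegers L), v.asIdeal.under (NumberField.RingOfIntegers K) = w.asIdeal → π.1.HasSatakeParamAt v (β v)) → ∃ α : Fin r → Multiset ℂ, (∀ i, (P i).1.HasSatakeParamAt w (α i)) ∧ Literature.NumberTheory.Automorphic.satakePolynomial (Finset.univ.sum α) = ∏ᶠ v ∈ {v : IsDedekindDomain.HeightOneSpectrum (NumberField.RingOfIntegers L) | v.asIdeal.under (NumberField.RingOfIntegers K) = w.asIdeal}, (Literature.NumberTheory.Automorphic.satakePolynomial (β v)).comp (Polynomial.X ^ v.asIdeal.inertiaDeg (NumberField.RingOfIntegers K)) := by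
  sorry

/-- **BC5 rung, plan-only (cyclic prime degree, off the Galois-stable locus).**  Granting the
vendored named facts `automorphicInduction_cyclic_cuspidal` (Arthur–Clozel 1989, Ch. 3, Thm. 6.2
with Lemma 6.4: for `L/K` cyclic of prime degree and cuspidal `π ≇ π^σ` there is a CUSPIDAL `P` on
`GL_(n[L:K])(𝔸_K)` automorphically induced from `π`), `Henniart2012_infinityType_of_automorphicInduction`
(the `z`-exponents of `P` at `σ` are the sum of those of `π` at the `σ' ∣ σ`) and the existence of
infinity types of cuspidal representations (Clozel 1990 §3.3), the crux holds with `r = 1` for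
`K` imaginary quadratic and `L/K` cyclic of prime degree when `π` is not Galois-stable in the Satake
sense: L-algebraicity of `P` from Henniart's identity and well-formedness (`b`-exponents at `σ` are
`a`-exponents at `σ̄`), the slope of `P` from the Satake identity (`‖∏ f-th roots of β_v‖ =
∏_(v ∣ w) ‖β_v.prod‖`), the slope of `π` from its central character.  This case lies inside the
domain of `stub_primitiveCase` (prime degree ⇒ primitive) and outside the summit's proved regime
(no reciprocity is known for general L-algebraic `π` over `L`).  Size: M.
[cite: ArthurClozelAMS120, Ch. 3 Thm. 6.2, Lemma 6.4] [cite: Henniart2012, §1.10, Thm. 3–5]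
[cite: Clozel1990, §3.3] -/
theorem stub_cyclicPrimeCase : Literature.NumberTheory.Automorphic.automorphicInduction_cyclic_cuspidal → Literature.NumberTheory.Automorphic.Henniart2012_infinityType_of_automorphicInduction → (∀ (N : ℕ) (F : Type) [Field F] [NumberField F] (hF : Literature.NumberTheory.Automorphic.isCompact_glFiniteIntegralLevel N F) (Q : Literature.NumberTheory.Automorphic.CuspidalAutomorphicRepData N F hF), Q.1.exists_hasInfinityType) → ∀ (K L : Type) [Field K] [NumberField K] [Field L] [NumberField L] [Algebra K L] [IsGalois K L], IsCyclic (L ≃ₐ[K] L) → (Module.finrank K L).Prime → NumberField.IsTotallyComplex K → Module.finrank ℚ K = 2 → ∀ (n : ℕ), 0 < n → ∀ (hL : Literature.NumberTheory.Automorphic.isCompact_glFiniteIntegralLevel n L) (π : Literature.NumberTheory.Automorphic.CuspidalAutomorphicRepData n L hL), π.1.IsLAlgebraic → ¬ Literature.NumberTheory.Automorphic.IsGaloisStableSatakeAE K π.1 → ∃ (r : ℕ) (m : Fin r → ℕ) (hK : ∀ i, Literature.NumberTheory.Automorphic.isCompact_glFiniteIntegralLevel (m i) K) (P : ∀ i,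 Literature.NumberTheory.Automorphic.CuspidalAutomorphicRepData (m i) K (hK i)), (∀ i, 0 < m i ∧ (P i).1.IsLAlgebraic) ∧ (∃ σ : ℝ, (∀ᶠ v : IsDedekindDomain.HeightOneSpectrum (NumberField.RingOfIntegers L) in cofinite, ∀ β : Multiset ℂ, π.1.HasSatakeParamAt v β → ‖β.prod‖ = (v.residueCard : ℝ) ^ ((n : ℝ) * σ)) ∧ ∀ i, ∀ᶠ w : IsDedekindDomain.HeightOneSpectrum (NumberField.RingOfIntegers K) in cofinite, ∀ α : Multiset ℂ, (P i).1.HasSatakeParamAt w α → ‖α.prod‖ = (w.residueCard : ℝ) ^ ((m i : ℝ) * σ)) ∧ ∀ᶠ w : IsDedekindDomain.HeightOneSpectrum (NumberField.RingOfIntegers K) in cofinite, ∀ β : IsDedekindDomain.HeightOneSpectrum (NumberField.RingOfIntegers L) → Multiset ℂ, (∀ v : IsDedekindDomain.HeightOneSpectrum (NumberField.RingOfIntegers L), v.asIdeal.under (NumberField.RingOfIntegers K) = w.asIdeal → π.1.HasSatakeParamAt v (β v)) → ∃ α : Fin r → Multiset ℂ, (∀ i, (P i).1.HasSatakeParamAt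 w (α i)) ∧ Literature.NumberTheory.Automorphic.satakePolynomial (Finset.univ.sum α) = ∏ᶠ v ∈ {v : IsDedekindDomain.HeightOneSpectrum (NumberField.RingOfIntegers L) | v.asIdeal.under (NumberField.RingOfIntegers K) = w.asIdeal}, (Literature.NumberTheory.Automorphic.satakePolynomial (β v)).comp (Polynomial.X ^ v.asIdeal.inertiaDeg (NumberField.RingOfIntegers K)) := by
  sorry

/-! ## Name-keyed statements of the registered stubs

`Registered.stub_X : Prop` is the statement of `stub_X` under the stub's own short name, so that the
hypotheses of `WeakAutomorphicInduction_of` read as the registered stubs BY NAME (the skeleton audit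
matches hypotheses to declared stubs by head constant). -/
namespace Registered

/-- Statement of `stub_primitiveCase` (the open core). -/
abbrev stub_primitiveCase : Prop :=
  ∀ (K L : Type) [Field K] [NumberField K] [Field L] [NumberField L] [Algebra K L], (∀ M : IntermediateField K L, M = ⊥ ∨ M = ⊤) → NumberField.IsTotallyComplex K → ∀ (n : ℕ), 0 < n → ∀ (hL : Literature.NumberTheory.Automorphic.isCompact_glFiniteIntegralLevel n L) (π : Literature.NumberTheory.Automorphic.CuspidalAutomorphicRepData n L hL), π.1.IsLAlgebraic → ∃ (r : ℕ) (m : Fin r → ℕ) (hK : ∀ i, Literature.NumberTheory.Automorphic.isCompact_glFiniteIntegralLevel (m i) K) (P : ∀ i, Literature.NumberTheory.Automorphic.CuspidalAutomorphicRepData (m i) K (hK i)), (∀ i, 0 < m i ∧ (P i).1.IsLAlgebraic) ∧ (∃ σ : ℝ, (∀ᶠ v : IsDedekindDomain.HeightOneSpectrum (NumberField.RingOfIntegers L) in cofinite, ∀ β : Multiset ℂ, π.1.HasSatakeParamAt v β → ‖β.prod‖ = (v.residueCard : ℝ) ^ ((n : ℝ) * σ)) ∧ ∀ i, ∀ᶠ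 w : IsDedekindDomain.HeightOneSpectrum (NumberField.RingOfIntegers K) in cofinite, ∀ α : Multiset ℂ, (P i).1.HasSatakeParamAt w α → ‖α.prod‖ = (w.residueCard : ℝ) ^ ((m i : ℝ) * σ)) ∧ ∀ᶠ w : IsDedekindDomain.HeightOneSpectrum (NumberField.RingOfIntegers K) in cofinite, ∀ β : IsDedekindDomain.HeightOneSpectrum (NumberField.RingOfIntegers L) → Multiset ℂ, (∀ v : IsDedekindDomain.HeightOneSpectrum (NumberField.RingOfIntegers L), v.asIdeal.under (NumberField.RingOfIntegers K) = w.asIdeal → π.1.HasSatakeParamAt v (β v)) → ∃ α : Fin r → Multiset ℂ, (∀ i, (P i).1.HasSatakeParamAt w (α i)) ∧ Literature.NumberTheory.Automorphic.satakePolynomial (Finset.univ.sum α) = ∏ᶠ v ∈ {v : IsDedekindDomain.HeightOneSpectrum (NumberField.RingOfIntegers L) | v.asIdeal.under (NumberField.RingOfIntegers K) = w.asIdeal}, (Literature.NumberTheory.Automorphic.satakePolynomial (β v)).comp (Polynomial.X ^ v.asIdeal.inertiaDeg (NumberField.RingOfIntegers K))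

/-- Statement of `stub_towerReduction` (induction in stages for families). -/
abbrev stub_towerReduction : Prop :=
  (∀ (K L : Type) [Field K] [NumberField K] [Field L] [NumberField L] [Algebra K L], (∀ M : IntermediateField K L, M = ⊥ ∨ M = ⊤) → NumberField.IsTotallyComplex K → ∀ (n : ℕ), 0 < n → ∀ (hL : Literature.NumberTheory.Automorphic.isCompact_glFiniteIntegralLevel n L) (π : Literature.NumberTheory.Automorphic.CuspidalAutomorphicRepData n L hL), π.1.IsLAlgebraic → ∃ (r : ℕ) (m : Fin r → ℕ) (hK : ∀ i, Literature.NumberTheory.Automorphic.isCompact_glFiniteIntegralLevel (m i) K) (P : ∀ i, Literature.NumberTheory.Automorphic.CuspidalAutomorphicRepData (m i) K (hK i)), (∀ i, 0 < m i ∧ (P i).1.IsLAlgebraic) ∧ (∃ σ : ℝ, (∀ᶠ v : IsDedekindDomain.HeightOneSpectrum (NumberField.RingOfIntegers L) in cofinite, ∀ β : Multiset ℂ, π.1.HasSatakeParamAt v β → ‖β.prod‖ = (v.residueCard : ℝ) ^ ((n : ℝ) * σ)) ∧ ∀ i, ∀ᶠ w : IsDedekindDomain.HeightOneSpectrum (NumberField.RingOfIntegers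 K) in cofinite, ∀ α : Multiset ℂ, (P i).1.HasSatakeParamAt w α → ‖α.prod‖ = (w.residueCard : ℝ) ^ ((m i : ℝ) * σ)) ∧ ∀ᶠ w : IsDedekindDomain.HeightOneSpectrum (NumberField.RingOfIntegers K) in cofinite, ∀ β : IsDedekindDomain.HeightOneSpectrum (NumberField.RingOfIntegers L) → Multiset ℂ, (∀ v : IsDedekindDomain.HeightOneSpectrum (NumberField.RingOfIntegers L), v.asIdeal.under (NumberField.RingOfIntegers K) = w.asIdeal → π.1.HasSatakeParamAt v (β v)) → ∃ α : Fin r → Multiset ℂ, (∀ i, (P i).1.HasSatakeParamAt w (α i)) ∧ Literature.NumberTheory.Automorphic.satakePolynomial (Finset.univ.sum α) = ∏ᶠ v ∈ {v : IsDedekindDomain.HeightOneSpectrum (NumberField.RingOfIntegers L) | v.asIdeal.under (NumberField.RingOfIntegers K) = w.asIdeal}, (Literature.NumberTheory.Automorphic.satakePolynomial (β v)).comp (Polynomial.X ^ v.asIdeal.inertiaDeg (NumberField.RingOfIntegers K))) → ∀ (K L : Type) [Field K] [NumberField K] [Field L] [NumberField L] [Algebra K L], NumberField.IsTotallyComplex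 K → ∀ (n : ℕ), 0 < n → ∀ (hL : Literature.NumberTheory.Automorphic.isCompact_glFiniteIntegralLevel n L) (π : Literature.NumberTheory.Automorphic.CuspidalAutomorphicRepData n L hL), π.1.IsLAlgebraic → ∃ (r : ℕ) (m : Fin r → ℕ) (hK : ∀ i, Literature.NumberTheory.Automorphic.isCompact_glFiniteIntegralLevel (m i) K) (P : ∀ i, Literature.NumberTheory.Automorphic.CuspidalAutomorphicRepData (m i) K (hK i)), (∀ i, 0 < m i ∧ (P i).1.IsLAlgebraic) ∧ (∃ σ : ℝ, (∀ᶠ v : IsDedekindDomain.HeightOneSpectrum (NumberField.RingOfIntegers L) in cofinite, ∀ β : Multiset ℂ, π.1.HasSatakeParamAt v β → ‖β.prod‖ = (v.residueCard : ℝ) ^ ((n : ℝ) * σ)) ∧ ∀ i, ∀ᶠ w : IsDedekindDomain.HeightOneSpectrum (NumberField.RingOfIntegers K) in cofinite, ∀ α : Multiset ℂ, (P i).1.HasSatakeParamAt w α → ‖α.prod‖ = (w.residueCard : ℝ) ^ ((m i : ℝ) * σ)) ∧ ∀ᶠ w : IsDedekindDomain.HeightOneSpectrum (NumberField.RingOfIntegers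 K) in cofinite, ∀ β : IsDedekindDomain.HeightOneSpectrum (NumberField.RingOfIntegers L) → Multiset ℂ, (∀ v : IsDedekindDomain.HeightOneSpectrum (NumberField.RingOfIntegers L), v.asIdeal.under (NumberField.RingOfIntegers K) = w.asIdeal → π.1.HasSatakeParamAt v (β v)) → ∃ α : Fin r → Multiset ℂ, (∀ i, (P i).1.HasSatakeParamAt w (α i)) ∧ Literature.NumberTheory.Automorphic.satakePolynomial (Finset.univ.sum α) = ∏ᶠ v ∈ {v : IsDedekindDomain.HeightOneSpectrum (NumberField.RingOfIntegers L) | v.asIdeal.under (NumberField.RingOfIntegers K) = w.asIdeal}, (Literature.NumberTheory.Automorphic.satakePolynomial (β v)).comp (Polynomial.X ^ v.asIdeal.inertiaDeg (NumberField.RingOfIntegers K))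

/-- Statement of `stub_cyclicPrimeCase` (BC5 plan-only rung; not a hypothesis of the assembly). -/
abbrev stub_cyclicPrimeCase : Prop :=
  Literature.NumberTheory.Automorphic.automorphicInduction_cyclic_cuspidal → Literature.NumberTheory.Automorphic.Henniart2012_infinityType_of_automorphicInduction → (∀ (N : ℕ) (F : Type) [Field F] [NumberField F] (hF : Literature.NumberTheory.Automorphic.isCompact_glFiniteIntegralLevel N F) (Q : Literature.NumberTheory.Automorphic.CuspidalAutomorphicRepData N F hF), Q.1.exists_hasInfinityType) → ∀ (K L : Type) [Field K] [NumberField K] [Field L] [NumberField L] [Algebra K L] [IsGalois K L], IsCyclic (L ≃ₐ[K] L) → (Module.finrank K L).Prime → NumberField.IsTotallyComplex K → Module.finrank ℚ K = 2 → ∀ (n : ℕ), 0 < n → ∀ (hL : Literature.NumberTheory.Automorphic.isCompact_glFiniteIntegralLevel n L) (π : Literature.NumberTheory.Automorphic.CuspidalAutomorphicRepData n L hL), π.1.IsLAlgebraic → ¬ Literature.NumberTheory.Automorphic.IsGaloisStableSatakeAE K π.1 → ∃ (r : ℕ) (m : Fin r → ℕ) (hK : ∀ i, Literature.NumberTheory.Automorphic.isCompact_glFiniteIntegralLevel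 (m i) K) (P : ∀ i, Literature.NumberTheory.Automorphic.CuspidalAutomorphicRepData (m i) K (hK i)), (∀ i, 0 < m i ∧ (P i).1.IsLAlgebraic) ∧ (∃ σ : ℝ, (∀ᶠ v : IsDedekindDomain.HeightOneSpectrum (NumberField.RingOfIntegers L) in cofinite, ∀ β : Multiset ℂ, π.1.HasSatakeParamAt v β → ‖β.prod‖ = (v.residueCard : ℝ) ^ ((n : ℝ) * σ)) ∧ ∀ i, ∀ᶠ w : IsDedekindDomain.HeightOneSpectrum (NumberField.RingOfIntegers K) in cofinite, ∀ α : Multiset ℂ, (P i).1.HasSatakeParamAt w α → ‖α.prod‖ = (w.residueCard : ℝ) ^ ((m i : ℝ) * σ)) ∧ ∀ᶠ w : IsDedekindDomain.HeightOneSpectrum (NumberField.RingOfIntegers K) in cofinite, ∀ β : IsDedekindDomain.HeightOneSpectrum (NumberField.RingOfIntegers L) → Multiset ℂ, (∀ v : IsDedekindDomain.HeightOneSpectrum (NumberField.RingOfIntegers L), v.asIdeal.under (NumberField.RingOfIntegers K) = w.asIdeal → π.1.HasSatakeParamAt v (β v)) → ∃ α : Fin r → Multiset ℂ, (∀ i,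 (P i).1.HasSatakeParamAt w (α i)) ∧ Literature.NumberTheory.Automorphic.satakePolynomial (Finset.univ.sum α) = ∏ᶠ v ∈ {v : IsDedekindDomain.HeightOneSpectrum (NumberField.RingOfIntegers L) | v.asIdeal.under (NumberField.RingOfIntegers K) = w.asIdeal}, (Literature.NumberTheory.Automorphic.satakePolynomial (β v)).comp (Polynomial.X ^ v.asIdeal.inertiaDeg (NumberField.RingOfIntegers K))

end Registered

/-! ## The composition (kernel-checked, no sorry of its own) -/

/-- **Assembly (kernel-checked, placeholder-free):** the two load-bearing stubs give the crux BY NAME —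
`stub_towerReduction stub_primitiveCase` is weak automorphic induction along every finite extension
of every totally complex base, and an imaginary quadratic field is totally complex (the hypothesis
`Module.finrank ℚ K = 2` is simply not needed downstream of `NumberField.IsTotallyComplex K`). -/
theorem WeakAutomorphicInduction_of (h₁ : Registered.stub_primitiveCase)
    (h₂ : Registered.stub_towerReduction) :
    Summit.Langlands.Langlands.Theses.ImaginaryQuadraticAnchor.WeakAutomorphicInduction := by
  intro K L _ _ _ _ _ htc _h2
  exact h₂ h₁ K L htc

/-- Wiring check: the registered (sorried) stubs feed `WeakAutomorphicInduction_of` as stated (an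
`example`, so that `WeakAutomorphicInduction_of` stays the unique theorem of this file concluding the
crux, and no `sorry` enters a named declaration other than the stubs). -/
example : Summit.Langlands.Langlands.Theses.ImaginaryQuadraticAnchor.WeakAutomorphicInduction :=
  WeakAutomorphicInduction_of stub_primitiveCase stub_towerReduction

/-- Sanity (no `sorry`): the rung's statement is the registered stub's statement, by `Iff.rfl`. -/
example : Registered.stub_cyclicPrimeCase ↔ (Literature.NumberTheory.Automorphic.automorphicInduction_cyclic_cuspidal → Literature.NumberTheory.Automorphic.Henniart2012_infinityType_of_automorphicInduction → (∀ (N : ℕ) (F : Type) [Field F] [NumberField F] (hF : Literature.NumberTheory.Automorphic.isCompact_glFiniteIntegralLevel N F) (Q : Literature.NumberTheory.Automorphic.CuspidalAutomorphicRepData N F hF), Q.1.exists_hasInfinityType) → ∀ (K L : Type) [Field K] [NumberField K] [Field L] [NumberField L] [Algebra K L] [IsGalois K L], IsCyclic (L ≃ₐ[K] L) → (Module.finrank K L).Prime → NumberField.IsTotallyComplex K → Module.finrank ℚ K = 2 → ∀ (n : ℕ), 0 < n → ∀ (hL : Literature.NumberTheory.Automorphic.isCompact_glFiniteIntegralLevel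 n L) (π : Literature.NumberTheory.Automorphic.CuspidalAutomorphicRepData n L hL), π.1.IsLAlgebraic → ¬ Literature.NumberTheory.Automorphic.IsGaloisStableSatakeAE K π.1 → ∃ (r : ℕ) (m : Fin r → ℕ) (hK : ∀ i, Literature.NumberTheory.Automorphic.isCompact_glFiniteIntegralLevel (m i) K) (P : ∀ i, Literature.NumberTheory.Automorphic.CuspidalAutomorphicRepData (m i) K (hK i)), (∀ i, 0 < m i ∧ (P i).1.IsLAlgebraic) ∧ (∃ σ : ℝ, (∀ᶠ v : IsDedekindDomain.HeightOneSpectrum (NumberField.RingOfIntegers L) in cofinite, ∀ β : Multiset ℂ, π.1.HasSatakeParamAt v β → ‖β.prod‖ = (v.residueCard : ℝ) ^ ((n : ℝ) * σ)) ∧ ∀ i, ∀ᶠ w : IsDedekindDomain.HeightOneSpectrum (NumberField.RingOfIntegers K) in cofinite, ∀ α : Multiset ℂ, (P i).1.HasSatakeParamAt w α → ‖α.prod‖ = (w.residueCard : ℝ) ^ ((m i : ℝ) * σ)) ∧ ∀ᶠ w : IsDedekindDomain.HeightOneSpectrum (NumberField.RingOfIntegers K) in cofinite, ∀ β : IsDedekindDomain.HeightOneSpectrum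 (NumberField.RingOfIntegers L) → Multiset ℂ, (∀ v : IsDedekindDomain.HeightOneSpectrum (NumberField.RingOfIntegers L), v.asIdeal.under (NumberField.RingOfIntegers K) = w.asIdeal → π.1.HasSatakeParamAt v (β v)) → ∃ α : Fin r → Multiset ℂ, (∀ i, (P i).1.HasSatakeParamAt w (α i)) ∧ Literature.NumberTheory.Automorphic.satakePolynomial (Finset.univ.sum α) = ∏ᶠ v ∈ {v : IsDedekindDomain.HeightOneSpectrum (NumberField.RingOfIntegers L) | v.asIdeal.under (NumberField.RingOfIntegers K) = w.asIdeal}, (Literature.NumberTheory.Automorphic.satakePolynomial (β v)).comp (Polynomial.X ^ v.asIdeal.inertiaDeg (NumberField.RingOfIntegers K))) := Iff.rfl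

end Summit.Langlands.Langlands.Cruxes.WeakAutomorphicInduction.Birth
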